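import Summits.HodgeConjecture.HodgeConjecture.Theorems.R90S6FlickerLiteralShiftUnit   -- FILE 2 sibling A: literal calculus `flickerLiteral_sub_smul_one ∕ _mul_ ∕ smul_ ∕ _add_`; brings ★ `LocalConjDatum`
import HarnessLib

/-!
# R90 · S6 — LINE S1, REGIME R-II, CARD R2M (FILE 2, sibling B): THE THREE ADJOIN LETTERS OF THE SHIFTED LITERAL `Y = T_θ(a, b′, c)` AND THEIR SCALARS
# (`Theorems/R90S6FlickerLiteralShiftAdjoin.lean`)

Cell `hodgecm-mathlib`, crux H413 (`stmt-HodgeConjecture-24833`), route of record `HCCMUnconditional`; programme R90-TF, section S6 (base `R90-C14`), seat R90-C14-p05 (g2);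
S6 dealer R90-C14-plan (g2) card R2M (2026-09-05T02:23:40Z), two-file cut «=» 02:31:48Z, head shapes «=» 02:47:13Z.  Helper lane `--supports stmt-HodgeConjecture-24833 --as helper`;
THEOREMS ONLY (no definition, no instance, no notation, no named fact, no `sorry`).  Feeds `Theorems/R90S6TorusFixedSpecialCountTwoCongruentFlicker.lean`, which instantiates
★ FILE 1 `natCard_fixedBy_special_eq_one_add_mul_natCard_fixedBy_of_mem_adjoin` (p864751) at the unit `Y`.

THE MATHEMATICS [Kottwitz1986BaseChangeUnits, §1 pp. 240–241, §3; Serre1980Trees, II §1.1; Flicker1998UnitaryFL, §2 Prop. 3 pp. 78–79].  For Flicker's literal `γ = T_θ(a, b, c)`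
(resp. `T_θ(a, c, b)`) and its SHIFT `Y = T_θ(a, b′, c)` (resp. `T_θ(a, c, b′)`) — same frame, the moved eigenvalue `b ↦ b′` — with `X₂ = ϖ⁻¹(γ − a·1)(γ − c·1)`, the literal
calculus of sibling A gives the MATRIX identities `Y = γ + λ·X₂`, `γ = Y + μ·(Y − a)(Y − c)`, `X₂ = ν·(Y − a)(Y − c)` with `λ = ϖ(b′−b)∕((b−a)(b−c))`, `μ = (b−b′)∕((b′−a)(b′−c))`,
`ν = ϖ⁻¹(b−a)(b−c)∕((b′−a)(b′−c))` (the fixed eigenlines carry a factor `a − a` resp. `c − c`), hence, when `|λ|, |μ|, |ν| ≤ 1` and `|a|, |c| ≤ 1`, the three ADJOIN LETTERS of ★ FILE 1: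
`Y ∈ 𝒪[γ, X₂]`, `γ ∈ 𝒪[Y]`, `X₂ ∈ 𝒪[Y]` (§2); and in regime R-II (`|a − b| = |ϖⁿ|`, `n ≥ 1`, `|a − c| = 1`) with the shift letter `|a − b′| = |ϖ^{n−1}|`, `|c − b′| = 1` one has
`|λ| = |μ| = |ν| = 1` (§3 `shift_scalar_letters`).  §1: scalars of valuation `≤ 1` act inside an `𝒪`-adjoin; the exponent of a non-zero integral element.
HONEST LABEL: matrix identities and valuation bookkeeping; count-neutral; proves no printed statement.  HC_CM is proved only modulo the 7 printed citations (2 remaining named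
inputs: hLiu418 = stmt-HodgeConjecture-24832, h413 = stmt-HodgeConjecture-24833) until rung 0 closes.

## References
* [Kottwitz1986BaseChangeUnits] R. E. Kottwitz, *Base change for unit elements of Hecke algebras*, Compositio Math. 60 (1986) 237–250, §1 pp. 240–241, §3.
* [Serre1980Trees] J.-P. Serre, *Trees*, Springer (1980), Ch. II §1.1.
* [Flicker1998UnitaryFL] Y. Z. Flicker, *Elementary proof of the fundamental lemma for a unitary group*, Canad. J. Math. 50 (1998) 74–98, §2 Prop. 3 pp. 78–79.
-/

set_option autoImplicit false
-- the mandated namespace repeats the single-problem summit's segment (`HodgeConjecture.HodgeConjecture`)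
set_option linter.dupNamespace false

noncomputable section

open Matrix
open Literature.NumberTheory.Automorphic Literature.NumberTheory.Automorphic.HermitianLattice
open scoped Matrix MatrixGroups WithZero Valued

namespace Summit.HodgeConjecture.HodgeConjecture.R90.S6

universe u

variable {K : Type u} [Field K] [Valued K ℤᵐ⁰]

/-! ### §1 Small letters: scalars of valuation `≤ 1` act inside an `𝒪`-adjoin; the exponent of an integral element -/

/-- A scalar of valuation `≤ 1` times a member of an `𝒪`-subalgebra `𝒪[s]` is a member. [cite: Serre1980Trees, Ch. II §1.1] -/
theorem smul_mem_adjoin_of_v_le_one {s : Set (Matrix (Fin 3) (Fin 3) K)} {M : Matrix (Fin 3) (Fin 3) K} (hM : M ∈ Algebra.adjoin 𝒪[K] s)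
    {t : K} (ht : Valued.v t ≤ 1) : t • M ∈ Algebra.adjoin 𝒪[K] s := by
  have e : t • M = (⟨t, ht⟩ : 𝒪[K]) • M := rfl
  rw [e]
  exact Subalgebra.smul_mem _ hM _

/-- `t·1 ∈ 𝒪[s]` for `|t| ≤ 1`. [cite: Serre1980Trees, Ch. II §1.1] -/
theorem smul_one_mem_adjoin_of_v_le_one (s : Set (Matrix (Fin 3) (Fin 3) K)) {t : K} (ht : Valued.v t ≤ 1) :
    t • (1 : Matrix (Fin 3) (Fin 3) K) ∈ Algebra.adjoin 𝒪[K] s :=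
  smul_mem_adjoin_of_v_le_one (Subalgebra.one_mem _) ht

/-- The exponent of a non-zero integral element: `|x| = |ϖ^N|` for some `N : ℕ`. [cite: Serre1980Trees, Ch. II §1.1] -/
theorem exists_v_eq_v_pow_of_ne_zero {σ : K →+* K} {ϖ : K} (hd : LocalConjDatum σ ϖ) {x : K} (hx0 : x ≠ 0) (hx : Valued.v x ≤ 1) :
    ∃ N : ℕ, Valued.v x = Valued.v (ϖ ^ N) := by
  have hvx : Valued.v x ≠ 0 := (Valuation.ne_zero_iff _).2 hx0
  refine ⟨(-WithZero.log (Valued.v x)).toNat, ?_⟩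
  have hlog : WithZero.log (Valued.v x) ≤ 0 := by
    rw [← WithZero.exp_le_exp, WithZero.exp_log hvx, WithZero.exp_zero]; exact hx
  rw [hd.v_pow, Int.toNat_of_nonneg (by omega), neg_neg, WithZero.exp_log hvx]

/-! ### §2 The adjoin letters of the shift `Y = T_θ(a, b′, c)` of `γ = T_θ(a, b, c)` (moved slot `y`) and of `Y = T_θ(a, c, b′)` (moved slot `z`) -/

section Adjoin

variable {σ : K →+* K} {ϖ : K}

/-- **The three adjoin letters for the middle-slot shift**: `γ = T_θ(a,b,c)`, `Y = T_θ(a,b′,c)` (`2e = 1`, `θθ′ = 1`, `ϖ ≠ 0`, `b ∉ {a, c}`, `b′ ∉ {a, c}`), with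
`X₂ = ϖ⁻¹(γ − a·1)(γ − c·1)`: if `|ϖ(b′−b)∕((b−a)(b−c))| ≤ 1`, `|(b−b′)∕((b′−a)(b′−c))| ≤ 1` and `|ϖ⁻¹(b−a)(b−c)∕((b′−a)(b′−c))| ≤ 1` then `Y ∈ 𝒪[γ, X₂]`, `γ ∈ 𝒪[Y]`,
`X₂ ∈ 𝒪[Y]` — by the matrix identities `Y = γ + λ·X₂`, `γ = Y + μ·(Y−a)(Y−c)`, `X₂ = ν·(Y−a)(Y−c)` of the literal calculus. [cite: Kottwitz1986BaseChangeUnits, §1 pp. 240–241, §3] -/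
theorem adjoin_letters_of_shift_mid {e θ θ' a b c b' : K} (h2e : 2 * e = 1) (hθ : θ * θ' = 1) (hϖ0 : ϖ ≠ 0)
    (hba : b - a ≠ 0) (hbc : b - c ≠ 0) (hb'a : b' - a ≠ 0) (hb'c : b' - c ≠ 0)
    (hl : Valued.v (ϖ * (b' - b) / ((b - a) * (b - c))) ≤ 1) (hm : Valued.v ((b - b') / ((b' - a) * (b' - c))) ≤ 1)
    (hn : Valued.v (ϖ⁻¹ * ((b - a) * (b - c)) / ((b' - a) * (b' - c))) ≤ 1) (hva : Valued.v a ≤ 1) (hvc : Valued.v c ≤ 1)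
    {γM YM : Matrix (Fin 3) (Fin 3) K} (hγ : γM = !![e * (a + c), 0, -(e * (a - c) * θ); 0, b, 0; -(e * (a - c) * θ'), 0, e * (a + c)])
    (hY : YM = !![e * (a + c), 0, -(e * (a - c) * θ); 0, b', 0; -(e * (a - c) * θ'), 0, e * (a + c)]) :
    YM ∈ Algebra.adjoin 𝒪[K] ({γM, ϖ⁻¹ • ((γM - a • (1 : Matrix (Fin 3) (Fin 3) K)) * (γM - c • (1 : Matrix (Fin 3) (Fin 3) K)))} : Set (Matrix (Fin 3) (Fin 3) K)) ∧
      γM ∈ Algebra.adjoin 𝒪[K] ({YM} : Set (Matrix (Fin 3) (Fin 3) K)) ∧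
      ϖ⁻¹ • ((γM - a • (1 : Matrix (Fin 3) (Fin 3) K)) * (γM - c • (1 : Matrix (Fin 3) (Fin 3) K))) ∈ Algebra.adjoin 𝒪[K] ({YM} : Set (Matrix (Fin 3) (Fin 3) K)) := by
  have hD : (b' - a) * (b' - c) ≠ 0 := mul_ne_zero hb'a hb'c
  have hD' : (b - a) * (b - c) ≠ 0 := mul_ne_zero hba hbc
  -- scalar bookkeeping on the three eigenlines (the fixed ones carry a factor `a − a` resp. `c − c`)
  have h1 : a + ϖ * (b' - b) / ((b - a) * (b - c)) * (ϖ⁻¹ * ((a - a) * (a - c))) = a := by ring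
  have h2 : b + ϖ * (b' - b) / ((b - a) * (b - c)) * (ϖ⁻¹ * ((b - a) * (b - c))) = b' := by field_simp; ring
  have h3 : c + ϖ * (b' - b) / ((b - a) * (b - c)) * (ϖ⁻¹ * ((c - a) * (c - c))) = c := by ring
  have k1 : a + (b - b') / ((b' - a) * (b' - c)) * ((a - a) * (a - c)) = a := by ring
  have k2 : b' + (b - b') / ((b' - a) * (b' - c)) * ((b' - a) * (b' - c)) = b := by rw [div_mul_cancel₀ _ hD]; ring
  have k3 : c + (b - b') / ((b' - a) * (b' - c)) * ((c - a) * (c - c)) = c := by ring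
  have l1 : ϖ⁻¹ * ((a - a) * (a - c)) = 0 := by ring
  have l3 : ϖ⁻¹ * ((c - a) * (c - c)) = 0 := by ring
  have r1 : ϖ⁻¹ * ((b - a) * (b - c)) / ((b' - a) * (b' - c)) * ((a - a) * (a - c)) = 0 := by ring
  have r2 : ϖ⁻¹ * ((b - a) * (b - c)) / ((b' - a) * (b' - c)) * ((b' - a) * (b' - c)) = ϖ⁻¹ * ((b - a) * (b - c)) := div_mul_cancel₀ _ hD
  have r3 : ϖ⁻¹ * ((b - a) * (b - c)) / ((b' - a) * (b' - c)) * ((c - a) * (c - c)) = 0 := by ring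
  -- the three matrix identities, by the literal calculus
  have eY : YM = γM + (ϖ * (b' - b) / ((b - a) * (b - c))) • (ϖ⁻¹ • ((γM - a • (1 : Matrix (Fin 3) (Fin 3) K)) * (γM - c • (1 : Matrix (Fin 3) (Fin 3) K)))) := by
    rw [hY, hγ]
    simp only [flickerLiteral_sub_smul_one h2e, flickerLiteral_mul_flickerLiteral h2e hθ, smul_flickerLiteral, flickerLiteral_add_flickerLiteral, h1, h2, h3]
  have eγ : γM = YM + ((b - b') / ((b' - a) * (b' - c))) • ((YM - a • (1 : Matrix (Fin 3) (Fin 3) K)) * (YM - c • (1 : Matrix (Fin 3) (Fin 3) K))) := by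
    rw [hY, hγ]
    simp only [flickerLiteral_sub_smul_one h2e, flickerLiteral_mul_flickerLiteral h2e hθ, smul_flickerLiteral, flickerLiteral_add_flickerLiteral, k1, k2, k3]
  have eX : ϖ⁻¹ • ((γM - a • (1 : Matrix (Fin 3) (Fin 3) K)) * (γM - c • (1 : Matrix (Fin 3) (Fin 3) K))) =
      (ϖ⁻¹ * ((b - a) * (b - c)) / ((b' - a) * (b' - c))) • ((YM - a • (1 : Matrix (Fin 3) (Fin 3) K)) * (YM - c • (1 : Matrix (Fin 3) (Fin 3) K))) := by
    rw [hY, hγ]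
    simp only [flickerLiteral_sub_smul_one h2e, flickerLiteral_mul_flickerLiteral h2e hθ, smul_flickerLiteral, l1, l3, r1, r2, r3]
  -- memberships
  have hYsub : YM ∈ Algebra.adjoin 𝒪[K] ({YM} : Set (Matrix (Fin 3) (Fin 3) K)) := Algebra.self_mem_adjoin_singleton 𝒪[K] YM
  have hprod : (YM - a • (1 : Matrix (Fin 3) (Fin 3) K)) * (YM - c • (1 : Matrix (Fin 3) (Fin 3) K)) ∈ Algebra.adjoin 𝒪[K] ({YM} : Set (Matrix (Fin 3) (Fin 3) K)) :=
    Subalgebra.mul_mem _ (Subalgebra.sub_mem _ hYsub (smul_one_mem_adjoin_of_v_le_one _ hva)) (Subalgebra.sub_mem _ hYsub (smul_one_mem_adjoin_of_v_le_one _ hvc))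
  refine ⟨?_, ?_, ?_⟩
  · rw [eY]
    exact Subalgebra.add_mem _ (Algebra.subset_adjoin (Set.mem_insert _ _))
      (smul_mem_adjoin_of_v_le_one (Algebra.subset_adjoin (Set.mem_insert_of_mem _ (Set.mem_singleton _))) hl)
  · rw [eγ]
    exact Subalgebra.add_mem _ hYsub (smul_mem_adjoin_of_v_le_one hprod hm)
  · rw [eX]
    exact smul_mem_adjoin_of_v_le_one hprod hn

/-- **The three adjoin letters for the last-slot shift**: `γ = T_θ(a,c,b)`, `Y = T_θ(a,c,b′)` (the `t₃ = t_ϖ(a,c,b)` pattern: the congruent pair `(a, b)` on the odd eigenlines,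
`c` in the middle), same scalars `λ, μ, ν` as in the middle-slot case. [cite: Kottwitz1986BaseChangeUnits, §1 pp. 240–241, §3] -/
theorem adjoin_letters_of_shift_last {e θ θ' a b c b' : K} (h2e : 2 * e = 1) (hθ : θ * θ' = 1) (hϖ0 : ϖ ≠ 0)
    (hba : b - a ≠ 0) (hbc : b - c ≠ 0) (hb'a : b' - a ≠ 0) (hb'c : b' - c ≠ 0)
    (hl : Valued.v (ϖ * (b' - b) / ((b - a) * (b - c))) ≤ 1) (hm : Valued.v ((b - b') / ((b' - a) * (b' - c))) ≤ 1)
    (hn : Valued.v (ϖ⁻¹ * ((b - a) * (b - c)) / ((b' - a) * (b' - c))) ≤ 1) (hva : Valued.v a ≤ 1) (hvc : Valued.v c ≤ 1)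
    {γM YM : Matrix (Fin 3) (Fin 3) K} (hγ : γM = !![e * (a + b), 0, -(e * (a - b) * θ); 0, c, 0; -(e * (a - b) * θ'), 0, e * (a + b)])
    (hY : YM = !![e * (a + b'), 0, -(e * (a - b') * θ); 0, c, 0; -(e * (a - b') * θ'), 0, e * (a + b')]) :
    YM ∈ Algebra.adjoin 𝒪[K] ({γM, ϖ⁻¹ • ((γM - a • (1 : Matrix (Fin 3) (Fin 3) K)) * (γM - c • (1 : Matrix (Fin 3) (Fin 3) K)))} : Set (Matrix (Fin 3) (Fin 3) K)) ∧
      γM ∈ Algebra.adjoin 𝒪[K] ({YM} : Set (Matrix (Fin 3) (Fin 3) K)) ∧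
      ϖ⁻¹ • ((γM - a • (1 : Matrix (Fin 3) (Fin 3) K)) * (γM - c • (1 : Matrix (Fin 3) (Fin 3) K))) ∈ Algebra.adjoin 𝒪[K] ({YM} : Set (Matrix (Fin 3) (Fin 3) K)) := by
  have hD : (b' - a) * (b' - c) ≠ 0 := mul_ne_zero hb'a hb'c
  have hD' : (b - a) * (b - c) ≠ 0 := mul_ne_zero hba hbc
  -- scalar bookkeeping on the three eigenlines (the fixed ones carry a factor `a − a` resp. `c − c`)
  have h1 : a + ϖ * (b' - b) / ((b - a) * (b - c)) * (ϖ⁻¹ * ((a - a) * (a - c))) = a := by ring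
  have h2 : b + ϖ * (b' - b) / ((b - a) * (b - c)) * (ϖ⁻¹ * ((b - a) * (b - c))) = b' := by field_simp; ring
  have h3 : c + ϖ * (b' - b) / ((b - a) * (b - c)) * (ϖ⁻¹ * ((c - a) * (c - c))) = c := by ring
  have k1 : a + (b - b') / ((b' - a) * (b' - c)) * ((a - a) * (a - c)) = a := by ring
  have k2 : b' + (b - b') / ((b' - a) * (b' - c)) * ((b' - a) * (b' - c)) = b := by rw [div_mul_cancel₀ _ hD]; ring
  have k3 : c + (b - b') / ((b' - a) * (b' - c)) * ((c - a) * (c - c)) = c := by ring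
  have l1 : ϖ⁻¹ * ((a - a) * (a - c)) = 0 := by ring
  have l3 : ϖ⁻¹ * ((c - a) * (c - c)) = 0 := by ring
  have r1 : ϖ⁻¹ * ((b - a) * (b - c)) / ((b' - a) * (b' - c)) * ((a - a) * (a - c)) = 0 := by ring
  have r2 : ϖ⁻¹ * ((b - a) * (b - c)) / ((b' - a) * (b' - c)) * ((b' - a) * (b' - c)) = ϖ⁻¹ * ((b - a) * (b - c)) := div_mul_cancel₀ _ hD
  have r3 : ϖ⁻¹ * ((b - a) * (b - c)) / ((b' - a) * (b' - c)) * ((c - a) * (c - c)) = 0 := by ring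
  -- the three matrix identities, by the literal calculus
  have eY : YM = γM + (ϖ * (b' - b) / ((b - a) * (b - c))) • (ϖ⁻¹ • ((γM - a • (1 : Matrix (Fin 3) (Fin 3) K)) * (γM - c • (1 : Matrix (Fin 3) (Fin 3) K)))) := by
    rw [hY, hγ]
    simp only [flickerLiteral_sub_smul_one h2e, flickerLiteral_mul_flickerLiteral h2e hθ, smul_flickerLiteral, flickerLiteral_add_flickerLiteral, h1, h2, h3]
  have eγ : γM = YM + ((b - b') / ((b' - a) * (b' - c))) • ((YM - a • (1 : Matrix (Fin 3) (Fin 3) K)) * (YM - c • (1 : Matrix (Fin 3) (Fin 3) K))) := by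
    rw [hY, hγ]
    simp only [flickerLiteral_sub_smul_one h2e, flickerLiteral_mul_flickerLiteral h2e hθ, smul_flickerLiteral, flickerLiteral_add_flickerLiteral, k1, k2, k3]
  have eX : ϖ⁻¹ • ((γM - a • (1 : Matrix (Fin 3) (Fin 3) K)) * (γM - c • (1 : Matrix (Fin 3) (Fin 3) K))) =
      (ϖ⁻¹ * ((b - a) * (b - c)) / ((b' - a) * (b' - c))) • ((YM - a • (1 : Matrix (Fin 3) (Fin 3) K)) * (YM - c • (1 : Matrix (Fin 3) (Fin 3) K))) := by
    rw [hY, hγ]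
    simp only [flickerLiteral_sub_smul_one h2e, flickerLiteral_mul_flickerLiteral h2e hθ, smul_flickerLiteral, l1, l3, r1, r2, r3]
  -- memberships
  have hYsub : YM ∈ Algebra.adjoin 𝒪[K] ({YM} : Set (Matrix (Fin 3) (Fin 3) K)) := Algebra.self_mem_adjoin_singleton 𝒪[K] YM
  have hprod : (YM - a • (1 : Matrix (Fin 3) (Fin 3) K)) * (YM - c • (1 : Matrix (Fin 3) (Fin 3) K)) ∈ Algebra.adjoin 𝒪[K] ({YM} : Set (Matrix (Fin 3) (Fin 3) K)) :=
    Subalgebra.mul_mem _ (Subalgebra.sub_mem _ hYsub (smul_one_mem_adjoin_of_v_le_one _ hva)) (Subalgebra.sub_mem _ hYsub (smul_one_mem_adjoin_of_v_le_one _ hvc))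
  refine ⟨?_, ?_, ?_⟩
  · rw [eY]
    exact Subalgebra.add_mem _ (Algebra.subset_adjoin (Set.mem_insert _ _))
      (smul_mem_adjoin_of_v_le_one (Algebra.subset_adjoin (Set.mem_insert_of_mem _ (Set.mem_singleton _))) hl)
  · rw [eγ]
    exact Subalgebra.add_mem _ hYsub (smul_mem_adjoin_of_v_le_one hprod hm)
  · rw [eX]
    exact smul_mem_adjoin_of_v_le_one hprod hn

/-! ### §3 The scalars `λ, μ, ν` in regime R-II -/

/-- **The scalar letters of regime R-II and of the shift** (`|a − b| = |ϖⁿ|`, `n ≥ 1`, `|a − c| = 1`, `|a − b′| = |ϖ^{n−1}|`, `|c − b′| = 1`, all of `a, b, c, b′` units):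
the non-vanishings and the three valuations `|λ|, |μ|, |ν| ≤ 1` (in fact `= 1`) of the adjoin letters. [cite: Kottwitz1986BaseChangeUnits, §1 pp. 240–241] -/
theorem shift_scalar_letters (hd : LocalConjDatum σ ϖ) {a b c b' : K}
    {n : ℕ} (hn1 : 1 ≤ n) (hab : Valued.v (a - b) = Valued.v (ϖ ^ n)) (hac : Valued.v (a - c) = 1)
    (hab' : Valued.v (a - b') = Valued.v (ϖ ^ (n - 1))) (hcb' : Valued.v (c - b') = 1) :
    b - a ≠ 0 ∧ b - c ≠ 0 ∧ b' - a ≠ 0 ∧ b' - c ≠ 0 ∧ Valued.v (a - b) < 1 ∧ Valued.v (b - c) = 1 ∧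
      Valued.v (ϖ * (b' - b) / ((b - a) * (b - c))) ≤ 1 ∧ Valued.v ((b - b') / ((b' - a) * (b' - c))) ≤ 1 ∧
      Valued.v (ϖ⁻¹ * ((b - a) * (b - c)) / ((b' - a) * (b' - c))) ≤ 1 := by
  have hϖ0 : ϖ ≠ 0 := hd.ϖ_ne_zero
  have hvϖ0 : Valued.v ϖ ≠ 0 := (Valuation.ne_zero_iff _).2 hϖ0
  have hpow : ∀ k : ℕ, Valued.v (ϖ ^ k) ≠ 0 := fun k => by rw [map_pow]; exact pow_ne_zero _ hvϖ0
  have hab1 : Valued.v (a - b) < 1 := by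
    rw [hab, hd.v_pow, ← WithZero.exp_zero, WithZero.exp_lt_exp]; omega
  have hba : Valued.v (b - a) = Valued.v (ϖ ^ n) := by rw [Valuation.map_sub_swap, hab]
  have hb'a : Valued.v (b' - a) = Valued.v (ϖ ^ (n - 1)) := by rw [Valuation.map_sub_swap, hab']
  have hba0 : b - a ≠ 0 := fun h => hpow n (by rw [← hba, h, map_zero])
  have hb'a0 : b' - a ≠ 0 := fun h => hpow (n - 1) (by rw [← hb'a, h, map_zero])
  have hbc : Valued.v (b - c) = 1 := by
    have e : b - c = (a - c) + (b - a) := by ring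
    rw [e, Valuation.map_add_eq_of_lt_left _ (by rw [hac, hba, ← hab]; exact hab1), hac]
  have hb'c : Valued.v (b' - c) = 1 := by rw [Valuation.map_sub_swap, hcb']
  have hbc0 : b - c ≠ 0 := fun h => by rw [h, map_zero] at hbc; exact zero_ne_one hbc
  have hb'c0 : b' - c ≠ 0 := fun h => by rw [h, map_zero] at hb'c; exact zero_ne_one hb'c
  -- `|b′ − b| = |ϖ^{n−1}|` (the two depths differ)
  have hlt : Valued.v (ϖ ^ n) < Valued.v (ϖ ^ (n - 1)) := by
    rw [hd.v_pow, hd.v_pow, WithZero.exp_lt_exp]; omega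
  have hb'b : Valued.v (b' - b) = Valued.v (ϖ ^ (n - 1)) := by
    have e : b' - b = (b' - a) + (a - b) := by ring
    rw [e, Valuation.map_add_eq_of_lt_left _ (by rw [hb'a, hab]; exact hlt), hb'a]
  have hbb' : Valued.v (b - b') = Valued.v (ϖ ^ (n - 1)) := by rw [Valuation.map_sub_swap, hb'b]
  -- exponent bookkeeping in `ℤᵐ⁰`
  have hn' : ((n - 1 : ℕ) : ℤ) = (n : ℤ) - 1 := by omega
  refine ⟨hba0, hbc0, hb'a0, hb'c0, hab1, hbc, ?_, ?_, ?_⟩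
  · rw [map_div₀, map_mul, map_mul, hb'b, hba, hbc, mul_one, hd.vϖ, hd.v_pow, hd.v_pow, ← WithZero.exp_add, ← WithZero.exp_sub, ← WithZero.exp_zero,
      WithZero.exp_le_exp]
    omega
  · rw [map_div₀, map_mul, hbb', hb'a, hb'c, mul_one, div_self (hpow _)]
  · rw [map_div₀, map_mul, map_mul, map_mul, map_inv₀, hba, hbc, hb'a, hb'c, mul_one, mul_one, hd.vϖ, hd.v_pow, hd.v_pow, ← WithZero.exp_neg,
      ← WithZero.exp_add, ← WithZero.exp_sub, ← WithZero.exp_zero, WithZero.exp_le_exp]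
    omega

end Adjoin

end Summit.HodgeConjecture.HodgeConjecture.R90.S6

end
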